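import Summits.QuantumFields.YangMills.Theorems.BalabanUVNodesK0RecordFormatNamesFluctQtCC
import Summits.QuantumFields.YangMills.Theorems.BalabanUVNodesPortS1QtCHop

/-!
# NODE O port — `stub_P0C` supply chain, brick B3 ((M1-c) bridges, owner memo `Lines/pta_residueW-P0C-SUPPLY-OWNER-v1.md` §3 ∕ ★★ DEF-1 g39's A2 answer): AT AN `SU(2)`-VALUED BACKGROUND
# DEF-1's COMPLEX-DATUM TWINS (§24s ✓`…K0RecordFormatNamesFluctQtCC`) ARE THE ed.29∕15d∕15e OBJECTS — `recordQtCC (coeField Vk) = recordQtC Vk`, `recordLQtCC (coeField Vk) = recordLQtC Vk`,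
# `recordCtCC (coeField Vk) = recordCtC Vk`, `recordLQtMatCC (coeField Vk) = (recordLQtMat Vk).map ↑`, …, `recordCopLocCC (coeField Vk) = (recordCopLoc Vk).map ↑` (one object seen from two sides)

Cell `ym-nodeO-ideate`, porter seat PT-A-1 (gen 10); `--kind proof --supports stmt-QuantumFields-27930 --as helper`; count-neutral.  [I] = [Balaban1987RG1]; [15] = [Balaban1985Variational].

WHAT IS PROVED (under the (0.4) guard `∀ c, Small expMeanLogSU Vk c`; the matrix bridges also under the loop-`ε`-closeness letters of ✓`su2CoordCt_recordLQtC_single`):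
* §1 `coe_inv_eq_star_of_SU` (`(↑U)⁻¹ = (↑U)⋆`, nonsingular inverse of a special unitary matrix); ★ `recordQtCC_coeField` (the holomorphic average of `↑Vk` IS `↑Ū(Vk)` under the guard, ✓`coe_avgFun_eq_avgMh`,
  and its inverse is its adjoint); ★ `recordLQtCC_coeField` (`fderiv` of equal functions), `recordCtCC_coeField`.
* §2 ★ `recordLQtMatCC_coeField` (✓`su2CoordCt_recordLQtC_single`), `recordLQtB0CC_coeField` (`= recordLQtB0C Vk = (recordLQtB0 Vk).map ↑`), `recordLQtOffCC_coeField`, `recordXLocCC_coeField`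
  (✓`map_algebraMap_nonsing_inv`), ★★ `recordCopLocCC_coeField` — `C_loc(↑Vk) = ↑C_loc(Vk)`.

HONEST FRAMING.  Identification bookkeeping (no estimate); the complex-datum objects are inhabited off the real slice by nothing proved here (their analyticity in `V`, the X-localized scheme, (M1)–(M5) untouched);
`stub_P0C`∕`stub_FE(step)` OPEN; ⟨27930⟩ OPEN 1∕3; ⟨26900⟩ 0∕4; NODE O 0∕1; COUNT 8∕28 · K 1∕4 UNMOVED; finite `𝕋⁴_{L^K}` at fixed ε — NOT continuum ∕ OS; **the Yang–Mills mass gap (Clay) is NOT proved by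
any of this.**  No `sorry`, no `def`, no `instance`; standard axioms only.
-/

noncomputable section

open scoped BigOperators Matrix.Norms.L2Operator Topology

namespace Summit.QuantumFields.YangMills.Theorems.BalabanUVNodesPortS1

open Summit.QuantumFields.YangMills.Theorems.K0RecordFormatNames
open Literature.MathematicalPhysics.QuantumFieldTheory.Balaban1983to89
open Literature.MathematicalPhysics.QuantumFieldTheory.Balaban1983to89.Node00
open Literature.MathematicalPhysics.QuantumFieldTheory.Balaban1983to89.T4Continuum (T4Family)
open Literature.MathematicalPhysics.QuantumFieldTheory.Balaban1983to89.B15AveragingHolomorphic (avgMh coe_avgFun_eq_avgMh)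
open Literature.MathematicalPhysics.QuantumFieldTheory.Balaban1983to89.BlockAveraging (Small Idx)
open Literature.MathematicalPhysics.QuantumFieldTheory.Balaban1983to89.ExpMeanLog (expMeanLogSU)
open _root_.Matrix

variable (F : T4Family)

/-! ## §1  `Q̃`, `LQ̃`, `C̃` -/

/-- The nonsingular inverse of a special unitary matrix is its adjoint: `(↑U)⁻¹ = (↑U)⋆`. [folklore] -/
theorem coe_inv_eq_star_of_SU (U : SU 2) : ((U : MatA 2))⁻¹ = star (U : MatA 2) :=
  Matrix.inv_eq_left_inv ((Matrix.mem_unitaryGroup_iff').1 U.2.1)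

/-- ★ **`recordQtCC (coeField Vk) = recordQtC Vk`** under the (0.4) guard at every coarse bond (the holomorphic average of `↑Vk` is `↑Ū(Vk)` there, whose inverse is its adjoint).
[cite: Balaban1987RG1, (2.4) p.266, p.267, (0.4) p.253] -/
theorem recordQtCC_coeField (k K : ℕ) (Vk : GaugeField (F.P K) k (SU 2)) (hVk : ∀ c, Small expMeanLogSU Vk c) (z : FluctIdx F k K → ℂ) :
    recordQtCC F k K (coeField Vk) z = recordQtC F k K Vk z := by
  funext c
  rw [recordQtCC_apply, recordQtC_apply, pertCC_coeField, ← coe_avgFun_eq_avgMh Vk c (hVk c), coe_inv_eq_star_of_SU]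
  rfl

/-- ★ **`recordLQtCC (coeField Vk) = recordLQtC Vk`** under the guard (`fderiv` at `0` of equal functions). [cite: Balaban1987RG1, p.267 («L is a linear transformation»)] -/
theorem recordLQtCC_coeField (k K : ℕ) (Vk : GaugeField (F.P K) k (SU 2)) (hVk : ∀ c, Small expMeanLogSU Vk c) :
    recordLQtCC F k K (coeField Vk) = recordLQtC F k K Vk := by
  have h : recordQtCC F k K (coeField Vk) = recordQtC F k K Vk := funext fun z => recordQtCC_coeField F k K Vk hVk z
  show fderiv ℂ (recordQtCC F k K (coeField Vk)) 0 = fderiv ℂ (recordQtC F k K Vk) 0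
  rw [h]

/-- `recordCtCC (coeField Vk) = recordCtC Vk` under the guard. [cite: Balaban1987RG1, (1.5) p.261, p.267] -/
theorem recordCtCC_coeField (k K : ℕ) (Vk : GaugeField (F.P K) k (SU 2)) (hVk : ∀ c, Small expMeanLogSU Vk c) (z : FluctIdx F k K → ℂ) :
    recordCtCC F k K (coeField Vk) z = recordCtC F k K Vk z := by
  show recordQtCC F k K (coeField Vk) z - recordLQtCC F k K (coeField Vk) z = recordQtC F k K Vk z - recordLQtC F k K Vk z
  rw [recordQtCC_coeField F k K Vk hVk, recordLQtCC_coeField F k K Vk hVk]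

/-! ## §2  The matrices `recordLQtMat`, `A₁`, `A₂`, `X = A₁⁻¹A₂`, `C_loc` -/

/-- ★ **`recordLQtMatCC (coeField Vk) = (recordLQtMat Vk).map ↑`** (✓`su2CoordCt_recordLQtC_single` after §1). [cite: Balaban1987RG1, p.267] -/
theorem recordLQtMatCC_coeField (k K : ℕ) (hk : k + 1 ≤ (F.P K).m + (F.P K).K) (Vk : GaugeField (F.P K) k (SU 2)) {ε : ℝ}
    (hε : ∀ (c : PBond (F.P K) (k + 1)) (i : Idx (F.P K)), ‖loopM (coeField Vk) c i - 1‖ ≤ ε) (hε50 : ε ≤ 1 / 50)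
    (hVk : ∀ c, Small expMeanLogSU Vk c) :
    recordLQtMatCC F k K (coeField Vk) = (recordLQtMat F k K Vk).map (algebraMap ℝ ℂ) := by
  ext cj i
  show su2CoordCt (recordLQtCC F k K (coeField Vk) (Pi.single i 1) cj.1) cj.2 = (algebraMap ℝ ℂ) (recordLQtMat F k K Vk cj i)
  rw [recordLQtCC_coeField F k K Vk hVk, su2CoordCt_recordLQtC_single F k K hk Vk hε hε50 hVk, Complex.coe_algebraMap]

/-- `recordLQtB0CC (coeField Vk) = recordLQtB0C Vk` (= `(recordLQtB0 Vk).map ↑`, ✓`…FluctHopC`). [cite: Balaban1987RG1, p.267–268] -/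
theorem recordLQtB0CC_coeField (k K : ℕ) (hk : k + 1 ≤ (F.P K).m + (F.P K).K) (Vk : GaugeField (F.P K) k (SU 2)) {ε : ℝ}
    (hε : ∀ (c : PBond (F.P K) (k + 1)) (i : Idx (F.P K)), ‖loopM (coeField Vk) c i - 1‖ ≤ ε) (hε50 : ε ≤ 1 / 50)
    (hVk : ∀ c, Small expMeanLogSU Vk c) :
    recordLQtB0CC F k K (coeField Vk) = recordLQtB0C F k K Vk := by
  ext cj c'j'
  show recordLQtMatCC F k K (coeField Vk) cj (recordB0 F k K c'j'.1, c'j'.2) = (recordLQtB0 F k K Vk).map (algebraMap ℝ ℂ) cj c'j'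
  rw [recordLQtMatCC_coeField F k K hk Vk hε hε50 hVk]
  rfl

/-- `recordLQtOffCC (coeField Vk) = (recordLQtOff Vk).map ↑`. [cite: Balaban1987RG1, p.267–268] -/
theorem recordLQtOffCC_coeField (k K : ℕ) (hk : k + 1 ≤ (F.P K).m + (F.P K).K) (Vk : GaugeField (F.P K) k (SU 2)) {ε : ℝ}
    (hε : ∀ (c : PBond (F.P K) (k + 1)) (i : Idx (F.P K)), ‖loopM (coeField Vk) c i - 1‖ ≤ ε) (hε50 : ε ≤ 1 / 50)
    (hVk : ∀ c, Small expMeanLogSU Vk c) :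
    recordLQtOffCC F k K (coeField Vk) = (recordLQtOff F k K Vk).map (algebraMap ℝ ℂ) := by
  ext cj i
  show recordLQtMatCC F k K (coeField Vk) cj i.1 = (algebraMap ℝ ℂ) (recordLQtMat F k K Vk cj i.1)
  rw [recordLQtMatCC_coeField F k K hk Vk hε hε50 hVk]
  rfl

/-- `recordXLocCC (coeField Vk) = (recordXLoc Vk).map ↑` (entrywise complexification commutes with the nonsingular inverse and with products, junk included).
[cite: Balaban1987RG1, p.267–268] -/
theorem recordXLocCC_coeField (k K : ℕ) (hk : k + 1 ≤ (F.P K).m + (F.P K).K) (Vk : GaugeField (F.P K) k (SU 2)) {ε : ℝ}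
    (hε : ∀ (c : PBond (F.P K) (k + 1)) (i : Idx (F.P K)), ‖loopM (coeField Vk) c i - 1‖ ≤ ε) (hε50 : ε ≤ 1 / 50)
    (hVk : ∀ c, Small expMeanLogSU Vk c) :
    recordXLocCC F k K (coeField Vk) = (recordXLoc F k K Vk).map (algebraMap ℝ ℂ) := by
  classical
  show (recordLQtB0CC F k K (coeField Vk))⁻¹ * recordLQtOffCC F k K (coeField Vk) = ((recordLQtB0 F k K Vk)⁻¹ * recordLQtOff F k K Vk).map (algebraMap ℝ ℂ)
  rw [recordLQtB0CC_coeField F k K hk Vk hε hε50 hVk, recordLQtOffCC_coeField F k K hk Vk hε hε50 hVk, Matrix.map_mul, ← map_algebraMap_nonsing_inv]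
  rfl

/-- ★★ **`C_loc(↑Vk) = ↑C_loc(Vk)`**: `recordCopLocCC (coeField Vk) = (recordCopLoc Vk).map ↑` — DEF-1's complex-datum parametrisation of `{LQ̃_V B′ = 0}` at an `SU(2)` background IS ed.15e's real one
read in `ℂ`. [cite: Balaban1987RG1, p.268 («B′ = CB»); Balaban1985Variational, Prop. 9 p.309] -/
theorem recordCopLocCC_coeField (k K : ℕ) (hk : k + 1 ≤ (F.P K).m + (F.P K).K) (Vk : GaugeField (F.P K) k (SU 2)) {ε : ℝ}
    (hε : ∀ (c : PBond (F.P K) (k + 1)) (i : Idx (F.P K)), ‖loopM (coeField Vk) c i - 1‖ ≤ ε) (hε50 : ε ≤ 1 / 50)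
    (hVk : ∀ c, Small expMeanLogSU Vk c) :
    recordCopLocCC F k K (coeField Vk) = (recordCopLoc F k K Vk).map (algebraMap ℝ ℂ) := by
  classical
  have hX := recordXLocCC_coeField F k K hk Vk hε hε50 hVk
  ext ij j
  rcases ij with cj | i
  · rw [recordCopLocCC_inl, hX, Matrix.map_apply, Matrix.map_apply]
    show -((algebraMap ℝ ℂ) (recordXLoc F k K Vk cj j)) = (algebraMap ℝ ℂ) (Matrix.fromRows (-(recordXLoc F k K Vk)) 1 (Sum.inl cj) j)
    rw [Matrix.fromRows_apply_inl, Matrix.neg_apply, map_neg]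
  · rw [recordCopLocCC_inr, Matrix.map_apply]
    show (1 : Matrix (NonB0Idx F k K) (NonB0Idx F k K) ℂ) i j = (algebraMap ℝ ℂ) (Matrix.fromRows (-(recordXLoc F k K Vk)) 1 (Sum.inr i) j)
    rw [Matrix.fromRows_apply_inr]
    by_cases h : i = j
    · subst h; simp
    · simp [Matrix.one_apply_ne h]

end Summit.QuantumFields.YangMills.Theorems.BalabanUVNodesPortS1

end
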